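import Literature.AlgebraicGeometry.HodgeTheory.HodgeGenericPointsComeagre
import Literature.AlgebraicGeometry.HodgeTheory.HodgeFramesOfWeightTwo
import Literature.AlgebraicGeometry.HodgeTheory.TransportedHodgeFiltrationOrthogonal
import HarnessLib

/-!
# The analytic dichotomy of Hodge loci for a projective family of SURFACES, from holomorphic frames of
# `F² = H^{2,0}` alone

Family `hodge`, layer `Literature/AlgebraicGeometry/HodgeTheory`. Theorems only (no definition, no named
fact). Written by the prover seat `hodge-nonav-20241-p1` (g17, cell `hodge-nonav`) as the core of brick
F-G of prover-Ax's programme «B4 RELATIVE RESIDUES» ∕ «GRIFFITHS-SURFACES» (route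
`HodgeConjecture/CyclicUnitaryPowers`), `--supports stmt-HodgeConjecture-19544`.

`HodgeGenericPointsComeagre.hodgeLociDichotomy_of_griffiths1968` proves the dichotomy «the Hodge locus
of a rational tensor is everything or nowhere dense, locally» for every smooth projective family from
the named fact `Griffiths1968_holomorphicHodgeSubbundles` (Voisin I Thm. 10.3: holomorphic frames of
EVERY `F^p` along flat trivialisations). For a family of SURFACES carrying a morphism `ε : 𝒳 ⟶ ℙᴺ`
immersing the fibres, this file proves the SAME conclusion from holomorphic frames of `F²H² = H^{2,0}`
ONLY (hypothesis `hF2`, in the shape of the binders `w₂ ∕ hw₂ ∕ hw₂hol` of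
`exists_subbundleFrames_of_weightTwo`, to be produced for hypersurface families by Griffiths residues):

* `hodgeLociDichotomy_of_weightTwoFrames` — `hF2` ⟹ the conclusion of
  `hodgeLociDichotomy_of_griffiths1968` verbatim for `k = 2`. Chain: the fixed polarization form
  `(Q_s)_ℂ` of the base fibre cuts out `F¹ = (F²)^⊥` along every transport
  (`forall_mem_F_one_comapEquiv_iff_of_closedImmersions`, `TransportedHodgeFiltrationOrthogonal`), so
  `exists_subbundleFrames_of_weightTwo` (`HodgeFramesOfWeightTwo`) upgrades the `F²`-frame to frames of
  all `F^p`; then `exists_holomorphicFrame_of_subbundleFrames` and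
  `hodgeLociDichotomy_of_holomorphicFrame` (identity principle) exactly as in the proof from Griffiths'
  fact. The order of quantifiers «for each admissible reference state `T₁`, a neighbourhood `W₀`»
  (weaker than Griffiths' «one `W` for all `T₁`») is all the dichotomy uses.
* `isMeagre_setOf_not_isHodgeGenericPoint_of_weightTwoFrames` — hence the non-Hodge-generic points of
  `S(ℂ)` form a MEAGRE set (`isMeagre_setOf_not_isHodgeGenericPoint_of_hodgeLociDichotomy`).

Honest scope: a reduction; the frames `hF2` are a hypothesis here. Nothing in this file says HC or any
rung is proved.

## References

* [VoisinHodgeI2002] C. Voisin, Hodge Theory and Complex Algebraic Geometry I (2002), §7.1.2, §10.2.1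
  Thm. 10.3.
* [VoisinHodgeII2003] C. Voisin, Hodge Theory and Complex Algebraic Geometry II (2003), §5.3.1
  Lemma 5.13.
* [Deligne1972WeilK3] P. Deligne, La conjecture de Weil pour les surfaces K3, Invent. Math. 15 (1972),
  Prop. 7.5.
-/

noncomputable section

open CategoryTheory AlgebraicGeometry
open _root_.Topology _root_.Filter
open scoped TensorProduct
open Literature.AlgebraicTopology.SingularHomology
open Literature.AlgebraicGeometry.Motives

namespace Literature.AlgebraicGeometry.HodgeTheory

section HodgeTheory

variable {𝒳 S : SchemeOver ℂ} (f : 𝒳 ⟶ S)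

/-- **The dichotomy of Hodge loci for a projective family of surfaces, from holomorphic frames of
`F² = H^{2,0}`** (Voisin II Lemma 5.13 ∕ Deligne 1972 Prop. 7.5, with Griffiths' holomorphy needed only
for the top Hodge bundle). Setting of `hodgeLociDichotomy_of_griffiths1968` with `n = k = 2`, plus a
morphism `ε : 𝒳 ⟶ ℙ^{N₀}` restricting to closed immersions of the fibres, and `hF2`: for every base
point `s`, every `t₁`, every neighbourhood `N` of `t₁` and every admissible reference state `T₁` at `t₁`,
a path-connected open `W₀ ∋ t₁` inside `N` and a chart `ψ` with a linearly independent frame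
`w₂ i t ∈ ℂ ⊗ H²(X_s; ℚ)` spanning `F²` of the transported Hodge structures along the continuations of
`T₁` inside `W₀`, with holomorphic coordinates on `ψ(W₀)`. Conclusion: verbatim that of
`hodgeLociDichotomy_of_griffiths1968`. [cite: VoisinHodgeII2003, §5.3.1 Lemma 5.13]
[cite: VoisinHodgeI2002, §7.1.2 and §10.2.1 Thm. 10.3] [cite: Deligne1972WeilK3, Prop. 7.5] -/
theorem hodgeLociDichotomy_of_weightTwoFrames [HodgeTensorFacts.{0, 0}] (d : ℕ)
    (hf : IsSmoothProjectiveFamily f 2) (hS : IsQuasiProjectiveOver S)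
    [AlgebraicGeometry.SmoothOfRelativeDimension d S.hom]
    (hU : IsCohomologicallyLocallyTrivialOn f (Set.univ : Set (ComplexPoints S)))
    (A : ∀ t : ComplexPoints S, HodgeModel 2 (fiberOver f t)) (hA : ∀ t, (A t).IsHodgeSymmetric)
    [∀ t, Module.Finite ℚ (singularCohomology ℚ ℚ (ComplexPoints (fiberOver f t)) 2)]
    {N₀ : ℕ} (hN₀ : 1 ≤ N₀) (ε : 𝒳 ⟶ projectiveSpace N₀ ℂ)
    (hε : ∀ t : ComplexPoints S, IsClosedImmersion (fiberι f t ≫ ε).left)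
    (hF2 : ∀ (s t₁ : (Set.univ : Set (ComplexPoints S))), ∀ N ∈ 𝓝 t₁,
      ∀ (T₁ : singularCohomology ℚ ℚ (ComplexPoints (fiberOver f s.1)) 2 ≃ₗ[ℚ]
        singularCohomology ℚ ℚ (ComplexPoints (fiberOver f t₁.1)) 2),
      (∃ δ₁ : Path.Homotopic.Quotient s t₁,
        ∀ v, ofRatClass _ 2 (T₁ v) = transportFun f 2 hU δ₁ (ofRatClass _ 2 v)) →
      ∃ W₀ : Set (Set.univ : Set (ComplexPoints S)), IsOpen W₀ ∧ t₁ ∈ W₀ ∧ W₀ ⊆ N ∧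
        IsPathConnected W₀ ∧
      ∃ ψ : OpenPartialHomeomorph (Set.univ : Set (ComplexPoints S)) (Fin d → ℂ), W₀ ⊆ ψ.source ∧
      ∃ (r₂ : ℕ) (w₂ : Fin r₂ → Set.Elem (Set.univ : Set (ComplexPoints S)) →
        ℂ ⊗[ℚ] singularCohomology ℚ ℚ (ComplexPoints (fiberOver f s.1)) 2),
        (∀ t ∈ W₀, ∀ (ε' : Path t₁ t), (∀ r', ε' r' ∈ W₀) →
          ∀ (T : singularCohomology ℚ ℚ (ComplexPoints (fiberOver f s.1)) 2 ≃ₗ[ℚ]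
            singularCohomology ℚ ℚ (ComplexPoints (fiberOver f t.1)) 2),
          (∀ v, ofRatClass _ 2 (T v) = transportFun f 2 hU ⟦ε'⟧ (ofRatClass _ 2 (T₁ v))) →
          LinearIndependent ℂ (fun i ↦ w₂ i t) ∧
            (((A t.1).hodgeStructure (hf.isSmoothProjective t.1) (hA t.1) 2).comapEquiv T).F 2 =
              Submodule.span ℂ (Set.range fun i ↦ w₂ i t)) ∧
        (∀ (i : Fin r₂)
          (φ : Module.Dual ℂ (ℂ ⊗[ℚ] singularCohomology ℚ ℚ (ComplexPoints (fiberOver f s.1)) 2)),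
          AnalyticOnNhd ℂ (fun z ↦ φ (w₂ i (ψ.symm z))) (ψ '' W₀)))
    (s t₁ : (Set.univ : Set (ComplexPoints S))) (N : Set (Set.univ : Set (ComplexPoints S)))
    (hN : N ∈ 𝓝 t₁) :
    ∃ W : Set (Set.univ : Set (ComplexPoints S)), IsOpen W ∧ t₁ ∈ W ∧ W ⊆ N ∧ IsPathConnected W ∧
      ∀ (a b : ℕ) (ζ : hodgeTensorSpace (singularCohomology ℚ ℚ (ComplexPoints (fiberOver f
        (Subtype.val s))) 2) a b) (x : (Set.univ : Set (ComplexPoints S))),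
        x ∈ W → ∀ (Tx : singularCohomology ℚ ℚ (ComplexPoints (fiberOver f (Subtype.val s))) 2 ≃ₗ[ℚ]
          singularCohomology ℚ ℚ (ComplexPoints (fiberOver f (Subtype.val x))) 2),
        (∃ δ : Path.Homotopic.Quotient s x,
          ∀ v, ofRatClass _ 2 (Tx v) = transportFun f 2 hU δ (ofRatClass _ 2 v)) →
        (∀ t ∈ W, ∀ (ε' : Path x t), (∀ r, ε' r ∈ W) → ∀ (T : singularCohomology ℚ ℚ (ComplexPoints
          (fiberOver f (Subtype.val s))) 2 ≃ₗ[ℚ]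
          singularCohomology ℚ ℚ (ComplexPoints (fiberOver f (Subtype.val t))) 2),
          (∀ v, ofRatClass _ 2 (T v) = transportFun f 2 hU ⟦ε'⟧ (ofRatClass _ 2 (Tx v))) →
          ζ ∈ ((((A t.1).hodgeStructure (hf.isSmoothProjective t.1) (hA t.1) 2).comapEquiv T).tensorSpace
            a b).hodgeClasses 0) ∨
        IsNowhereDense {t : (Set.univ : Set (ComplexPoints S)) | t ∈ W ∧ ∀ (ε' : Path x t),
          (∀ r, ε' r ∈ W) → ∀ (T : singularCohomology ℚ ℚ (ComplexPoints (fiberOver f (Subtype.val s))) 2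
            ≃ₗ[ℚ] singularCohomology ℚ ℚ (ComplexPoints (fiberOver f (Subtype.val t))) 2),
          (∀ v, ofRatClass _ 2 (T v) = transportFun f 2 hU ⟦ε'⟧ (ofRatClass _ 2 (Tx v))) →
          ζ ∈ ((((A t.1).hodgeStructure (hf.isSmoothProjective t.1) (hA t.1) 2).comapEquiv T).tensorSpace
            a b).hodgeClasses 0} := by
  classical
  -- topology of `S(ℂ)`: a manifold, hence locally path connected
  haveI : AlgebraicGeometry.LocallyOfFiniteType S.hom := hS.locallyOfFiniteType
  haveI : AlgebraicGeometry.IsSeparated S.hom := hS.isVarietyPair_ofScheme.isSeparated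
  haveI : T2Space (ComplexPoints S) := Literature.NumberTheory.Transcendental.t2Space_algPoints_holds _ ℂ
  letI := Motives.ComplexPoints.chartedSpace S d
  haveI : LocallyPathConnectedSpace (ComplexPoints S) :=
    ChartedSpace.locallyPathConnectedSpace (EuclideanSpace ℝ (Fin (2 * d))) _
  haveI : LocallyPathConnectedSpace (Set.univ : Set (ComplexPoints S)) :=
    isOpen_univ.locallyPathConnectedSpace
  have hrat : ∀ (x y : (Set.univ : Set (ComplexPoints S))) (γ : Path.Homotopic.Quotient x y)
      (α : complexBetti (fiberOver f x.1) 2), IsRationalClass α →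
      IsRationalClass (transportFun f 2 hU γ α) :=
    fun x y γ α hα ↦ isRationalClass_transportFun_of_isSmoothProjectiveFamily f 2 d hf hS γ hα
  -- the weight-`2` Hodge structures of the fibres
  set H : ∀ t : (Set.univ : Set (ComplexPoints S)),
      HodgeStructure (singularCohomology ℚ ℚ (ComplexPoints (fiberOver f t.1)) 2) 2 :=
    fun t ↦ (A t.1).hodgeStructure (hf.isSmoothProjective t.1) (hA t.1) 2 with hHdef
  have hF0 : ∀ t : (Set.univ : Set (ComplexPoints S)), (H t).F 0 = ⊤ := fun t ↦ by
    rw [hHdef, HodgeModel.hodgeStructure_F]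
    exact (A t.1).ratF_of_nonpos (hf.isSmoothProjective t.1) 2 le_rfl
  have hF3 : ∀ t : (Set.univ : Set (ComplexPoints S)), (H t).F 3 = ⊥ := fun t ↦ by
    rw [hHdef, HodgeModel.hodgeStructure_F]
    exact (A t.1).ratF_eq_bot (hf.isSmoothProjective t.1) 2 (by norm_num)
  by_cases hjs : Joined s t₁
  · -- an admissible reference state at `t₁`
    obtain ⟨T₁, hT₁⟩ := exists_ratTransport f 2 hU hrat (⟦hjs.somePath⟧ : Path.Homotopic.Quotient s t₁)
    have hT₁' : ∃ δ₁ : Path.Homotopic.Quotient s t₁,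
        ∀ v, ofRatClass _ 2 (T₁ v) = transportFun f 2 hU δ₁ (ofRatClass _ 2 v) := ⟨_, hT₁⟩
    -- the `F²`-frame around `t₁` for this state
    obtain ⟨W₀, hW₀o, ht₁W₀, hW₀N, hW₀pc, ψ, hW₀ψ, r₂, w₂, hw₂, hw₂hol⟩ := hF2 s t₁ N hN T₁ hT₁'
    -- the fixed polarization form of the base fibre: `hB`, `hB1`
    have hX : ∀ t : (Set.univ : Set (ComplexPoints S)), IsSmoothProjective 2 (fiberOver f t.1) :=
      fun t ↦ hf.isSmoothProjective t.1
    haveI := hε s.1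
    obtain ⟨Ds, cs, hDs⟩ := exists_kaehlerRationalDatum_eq_map (hX s) (fiberι f s.1 ≫ ε)
    have hB := KaehlerRationalDatum.separatingRight_form_baseChange (hX s) Ds (A s.1) (hA s.1) 2
    have hB1 := forall_mem_F_one_comapEquiv_iff_of_closedImmersions f hU hN₀ ε hX (fun t ↦ hε t.1)
      (fun t ↦ A t.1) (fun t ↦ hA t.1) s Ds cs hDs hT₁' W₀
    -- frames of every `F^p` on a smaller `W₁`
    obtain ⟨W₁, hW₁o, ht₁W₁, hW₁W₀, hW₁pc, hfr⟩ := exists_subbundleFrames_of_weightTwo f 2 hU s H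
      hF0 hF3 hW₀o ψ hW₀ψ ht₁W₀ ((Ds.form (hX s) 2).baseChange ℂ) hB hB1 w₂ hw₂ hw₂hol
    choose r w hw hwhol using hfr
    -- graded holomorphic frames for every admissible base state on a smaller `W`, then the dichotomy
    obtain ⟨W, hWo, ht₁W, hWW₁, hWpc, hW⟩ := exists_holomorphicFrame_of_subbundleFrames f 2 hU s hrat
      H hW₁o hW₁pc ψ (hW₁W₀.trans hW₀ψ) ht₁W₁ hT₁' r w hw hwhol
    refine ⟨W, hWo, ht₁W, (hWW₁.trans hW₁W₀).trans hW₀N, hWpc, fun a b ζ x hx Tx hTx ↦ ?_⟩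
    obtain ⟨N', deg, e, hF, hol₁, hol₂⟩ := hW x hx Tx hTx
    exact hodgeLociDichotomy_of_holomorphicFrame f 2 hU s hrat H hWo hWpc ψ
      ((hWW₁.trans hW₁W₀).trans hW₀ψ) hx hTx e hF hol₁ hol₂ a b ζ
  · -- no admissible state near `t₁`: the condition is void on the path component of `t₁` in `N°`
    have ht₁N : t₁ ∈ interior N := mem_interior_iff_mem_nhds.2 hN
    refine ⟨pathComponentIn (interior N) t₁, isOpen_interior.pathComponentIn t₁,
      mem_pathComponentIn_self ht₁N, pathComponentIn_subset.trans interior_subset,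
      isPathConnected_pathComponentIn ht₁N, fun a b ζ x hx Tx hTx ↦ ?_⟩
    exfalso
    obtain ⟨δ, -⟩ := hTx
    induction δ using Quotient.inductionOn with
    | h γ =>
      exact hjs (Joined.trans ⟨γ⟩
        ((isPathConnected_pathComponentIn ht₁N).joinedIn x hx t₁ (mem_pathComponentIn_self ht₁N)).joined)

/-- **The non-Hodge-generic points of a projective family of surfaces form a meagre set, from
holomorphic frames of `F² = H^{2,0}`** (Deligne 1972 Prop. 7.5 ∕ André's Baire argument, the tree's
`isMeagre_setOf_not_isHodgeGenericPoint_of_hodgeLociDichotomy`, fed with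
`hodgeLociDichotomy_of_weightTwoFrames`). [cite: Deligne1972WeilK3, Prop. 7.5]
[cite: VoisinHodgeII2003, §5.3.1 Lemma 5.13] -/
theorem isMeagre_setOf_not_isHodgeGenericPoint_of_weightTwoFrames [HodgeTensorFacts.{0, 0}] (d : ℕ)
    (hf : IsSmoothProjectiveFamily f 2) (hS : IsQuasiProjectiveOver S)
    [AlgebraicGeometry.SmoothOfRelativeDimension d S.hom]
    (hU : IsCohomologicallyLocallyTrivialOn f (Set.univ : Set (ComplexPoints S)))
    (A : ∀ t : ComplexPoints S, HodgeModel 2 (fiberOver f t)) (hA : ∀ t, (A t).IsHodgeSymmetric)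
    [∀ t, Module.Finite ℚ (singularCohomology ℚ ℚ (ComplexPoints (fiberOver f t)) 2)]
    {N₀ : ℕ} (hN₀ : 1 ≤ N₀) (ε : 𝒳 ⟶ projectiveSpace N₀ ℂ)
    (hε : ∀ t : ComplexPoints S, IsClosedImmersion (fiberι f t ≫ ε).left)
    (hF2 : ∀ (s t₁ : (Set.univ : Set (ComplexPoints S))), ∀ N ∈ 𝓝 t₁,
      ∀ (T₁ : singularCohomology ℚ ℚ (ComplexPoints (fiberOver f s.1)) 2 ≃ₗ[ℚ]
        singularCohomology ℚ ℚ (ComplexPoints (fiberOver f t₁.1)) 2),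
      (∃ δ₁ : Path.Homotopic.Quotient s t₁,
        ∀ v, ofRatClass _ 2 (T₁ v) = transportFun f 2 hU δ₁ (ofRatClass _ 2 v)) →
      ∃ W₀ : Set (Set.univ : Set (ComplexPoints S)), IsOpen W₀ ∧ t₁ ∈ W₀ ∧ W₀ ⊆ N ∧
        IsPathConnected W₀ ∧
      ∃ ψ : OpenPartialHomeomorph (Set.univ : Set (ComplexPoints S)) (Fin d → ℂ), W₀ ⊆ ψ.source ∧
      ∃ (r₂ : ℕ) (w₂ : Fin r₂ → Set.Elem (Set.univ : Set (ComplexPoints S)) →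
        ℂ ⊗[ℚ] singularCohomology ℚ ℚ (ComplexPoints (fiberOver f s.1)) 2),
        (∀ t ∈ W₀, ∀ (ε' : Path t₁ t), (∀ r', ε' r' ∈ W₀) →
          ∀ (T : singularCohomology ℚ ℚ (ComplexPoints (fiberOver f s.1)) 2 ≃ₗ[ℚ]
            singularCohomology ℚ ℚ (ComplexPoints (fiberOver f t.1)) 2),
          (∀ v, ofRatClass _ 2 (T v) = transportFun f 2 hU ⟦ε'⟧ (ofRatClass _ 2 (T₁ v))) →
          LinearIndependent ℂ (fun i ↦ w₂ i t) ∧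
            (((A t.1).hodgeStructure (hf.isSmoothProjective t.1) (hA t.1) 2).comapEquiv T).F 2 =
              Submodule.span ℂ (Set.range fun i ↦ w₂ i t)) ∧
        (∀ (i : Fin r₂)
          (φ : Module.Dual ℂ (ℂ ⊗[ℚ] singularCohomology ℚ ℚ (ComplexPoints (fiberOver f s.1)) 2)),
          AnalyticOnNhd ℂ (fun z ↦ φ (w₂ i (ψ.symm z))) (ψ '' W₀))) :
    IsMeagre {t : (Set.univ : Set (ComplexPoints S)) | ¬ IsHodgeGenericPoint f 2 hU hf A hA t} :=
  isMeagre_setOf_not_isHodgeGenericPoint_of_hodgeLociDichotomy f 2 2 d hf hS hU A hA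
    fun s t₁ N hN ↦ hodgeLociDichotomy_of_weightTwoFrames f d hf hS hU A hA hN₀ ε hε hF2 s t₁ N hN

/-! ### Consumer form (appended): a meagre exceptional set -/

/-- **Consumer form** of `isMeagre_setOf_not_isHodgeGenericPoint_of_weightTwoFrames`: there is a MEAGRE
subset `M ⊆ S(ℂ)` such that every point off `M` is Hodge generic — verbatim the shape of
`exists_isMeagre_isHodgeGenericPoint_of_griffiths1968` with Griffiths' named fact replaced by the
`F²`-frames `hF2` and the fibrewise projective embedding `ε`. [cite: Deligne1972WeilK3, Prop. 7.5]
[cite: VoisinHodgeII2003, §5.3.1 Lemma 5.13] -/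
theorem exists_isMeagre_isHodgeGenericPoint_of_weightTwoFrames [HodgeTensorFacts.{0, 0}]
    {𝒳 S : SchemeOver ℂ} (f : 𝒳 ⟶ S) (d : ℕ)
    (hf : IsSmoothProjectiveFamily f 2) (hS : IsQuasiProjectiveOver S)
    [AlgebraicGeometry.SmoothOfRelativeDimension d S.hom]
    (hU : IsCohomologicallyLocallyTrivialOn f (Set.univ : Set (ComplexPoints S)))
    (A : ∀ t : ComplexPoints S, HodgeModel 2 (fiberOver f t)) (hA : ∀ t, (A t).IsHodgeSymmetric)
    [∀ t, Module.Finite ℚ (singularCohomology ℚ ℚ (ComplexPoints (fiberOver f t)) 2)]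
    {N₀ : ℕ} (hN₀ : 1 ≤ N₀) (ε : 𝒳 ⟶ projectiveSpace N₀ ℂ)
    (hε : ∀ t : ComplexPoints S, IsClosedImmersion (fiberι f t ≫ ε).left)
    (hF2 : ∀ (s t₁ : (Set.univ : Set (ComplexPoints S))), ∀ N ∈ 𝓝 t₁,
      ∀ (T₁ : singularCohomology ℚ ℚ (ComplexPoints (fiberOver f s.1)) 2 ≃ₗ[ℚ]
        singularCohomology ℚ ℚ (ComplexPoints (fiberOver f t₁.1)) 2),
      (∃ δ₁ : Path.Homotopic.Quotient s t₁,
        ∀ v, ofRatClass _ 2 (T₁ v) = transportFun f 2 hU δ₁ (ofRatClass _ 2 v)) →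
      ∃ W₀ : Set (Set.univ : Set (ComplexPoints S)), IsOpen W₀ ∧ t₁ ∈ W₀ ∧ W₀ ⊆ N ∧
        IsPathConnected W₀ ∧
      ∃ ψ : OpenPartialHomeomorph (Set.univ : Set (ComplexPoints S)) (Fin d → ℂ), W₀ ⊆ ψ.source ∧
      ∃ (r₂ : ℕ) (w₂ : Fin r₂ → Set.Elem (Set.univ : Set (ComplexPoints S)) →
        ℂ ⊗[ℚ] singularCohomology ℚ ℚ (ComplexPoints (fiberOver f s.1)) 2),
        (∀ t ∈ W₀, ∀ (ε' : Path t₁ t), (∀ r', ε' r' ∈ W₀) →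
          ∀ (T : singularCohomology ℚ ℚ (ComplexPoints (fiberOver f s.1)) 2 ≃ₗ[ℚ]
            singularCohomology ℚ ℚ (ComplexPoints (fiberOver f t.1)) 2),
          (∀ v, ofRatClass _ 2 (T v) = transportFun f 2 hU ⟦ε'⟧ (ofRatClass _ 2 (T₁ v))) →
          LinearIndependent ℂ (fun i ↦ w₂ i t) ∧
            (((A t.1).hodgeStructure (hf.isSmoothProjective t.1) (hA t.1) 2).comapEquiv T).F 2 =
              Submodule.span ℂ (Set.range fun i ↦ w₂ i t)) ∧
        (∀ (i : Fin r₂)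
          (φ : Module.Dual ℂ (ℂ ⊗[ℚ] singularCohomology ℚ ℚ (ComplexPoints (fiberOver f s.1)) 2)),
          AnalyticOnNhd ℂ (fun z ↦ φ (w₂ i (ψ.symm z))) (ψ '' W₀))) :
    ∃ M : Set (ComplexPoints S), IsMeagre M ∧
      ∀ s : (Set.univ : Set (ComplexPoints S)), s.1 ∉ M → IsHodgeGenericPoint f 2 hU hf A hA s := by
  refine ⟨Subtype.val '' {t : (Set.univ : Set (ComplexPoints S)) | ¬ IsHodgeGenericPoint f 2 hU hf A hA t},
    (isMeagre_setOf_not_isHodgeGenericPoint_of_weightTwoFrames f d hf hS hU A hA hN₀ ε hε hF2).image_val, ?_⟩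
  intro s hs
  by_contra h
  exact hs ⟨s, h, rfl⟩

end HodgeTheory


end Literature.AlgebraicGeometry.HodgeTheory

end
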